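import Literature.AnabelianGeometry.EtaleTheta.Discharge.Sec5Thm57FinalKnitV6OfMLFSetting
import Literature.AnabelianGeometry.EtaleTheta.Discharge.Sec5Thm57FinalKnitV6OfThetaSettingNonDilatingOfEtaleHsepPow

/-!
# [EtTh] §5, Theorem 5.7 — FINAL KNIT v6 at the tower of the Setting over an MLF, `hinvp` from the kernel: the LEANEST DISPLAY OF RECORD
# (p486421 thm 1) WITH THE REPAIRED separation binder `hsep^{(2l)}` — inhabited at the Tate datum of record (p503064)

Mochizuki, *The étale theta function and its Frobenioid-theoretic manifestations*, Publ. RIMS **45** (2009)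
[cite: MochizukiEtTh2009, Thm 5.7 p.329–330 (PDF pp.103–104); Prop 3.2 (iii) p.296 (PDF p.70); Thm 5.6 p.328 (PDF p.102); Cor 2.8 (i)
p.268 (PDF p.42)].  Layer L2 of the abc-iut cell, seat abc-iut-f-123 (gen 8), abc-iut-L2-lead rows R983/R1139/R1164 «HSEP@TATE-DATUM».
PROOF-ONLY twin (0 definitions) of this lineage's `Sec5Thm57FinalKnitV6OfMLFSetting` thm 1 (p486421): statement and proof VERBATIM
except that the cross-level separation binder `hsep` is the REPAIRED exponent-`2·l` form and the junction theorem is this seat's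
`…_final_v6_treeMonoidVocab_of_cor219iiiStd_of_hsepPow`.  WHY: the exponent-`2` `hsep` of p486421 is UNINHABITABLE at the Tate datum
of record for `l ∣ p − 1` (p498173; abstractly whenever `μ_l ⊆ K`, p497402), whereas `hsep^{(2l)}` HOLDS there for every `p`
(p503064) and reduces to Prop. 1.5 (ii)/(iii)-shaped inputs in general (p500847).  Binder list, vocabulary and conclusion otherwise
token-identical to p486421 thm 1 (42 displayed binders; census THM57-RESIDUAL-CLASSIFICATION-v2.tsv row 41 «T-at-datum» after this swap).
HONEST FRAMING: kernel-checked composition over typed statements; one-binder substitutions into landed theorems; none of the GAP-class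
binders is proved here; nothing of [EtTh] beyond Prop. 3.2 (iii) is asserted; typed ≠ discharged; no side taken on [IUTchIII] Cor. 3.12.
-/

noncomputable section

namespace Literature.AnabelianGeometry.EtaleTheta

open CategoryTheory Opposite Literature.AlgebraicGeometry.Frobenioids Literature.AnabelianGeometry.SemiGraphs
  Literature.AnabelianGeometry.SemiGraphs.GaloisObjects

universe v₀ u₁ v₁

namespace ThetaFrobenioidTower

section CanonicalV6EMLFKHsepPow

variable {p : ℕ} [Fact p.Prime] {DS : ThetaSetting p} {ES : DS.EtaleThetaData} {l' : ℕ} (Cu : ES.DoubleUnderline l')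
  {e' : DS.toTemperedCurve.GroupLevelData} {Es : Set ℕ+} (τ : DS.CyclotomeTower l' Es) (hC : DS.Compat) (hS : DS.Sec2Hyps)
  {D₀ : Type} [Category.{v₀} D₀] {T₀ : RealifiedDivisorMonoids (D₀ := D₀) treeMonoidVocab.{0}}
  {VD : FrdICatStub.{1, 0, 0} (ConnectedPart (BTemp (Cu.temperedArithmeticGroup e').Pi))}
  {tf : TemperedFrobenioid T₀ (ConnectedPart (BTemp (Cu.temperedArithmeticGroup e').Pi)) VD} {hZ : tf.monoidType = MonoidType.Z}
  {hP : ∀ A : (ConnectedPart (BTemp (Cu.temperedArithmeticGroup e').Pi))ᵒᵖ, IsPerfect (tf.Φ.carrier A)}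
  {NH : Subgroup (Field.absoluteGaloisGroup DS.K) → tf.category → ℕ+ → Prop}
  {pullFrac : ∀ {A A' : (BiKummerSetting.mkOfConnectedTemperoidYddTower (Cu.temperedArithmeticGroup e') tf hZ hP NH (Cu.thetaEnvTower τ hC hS)
    (ContinuousMulEquiv.refl _)).C} (_ : A' ⟶ A), (BiKummerSetting.mkOfConnectedTemperoidYddTower (Cu.temperedArithmeticGroup e') tf hZ hP NH
    (Cu.thetaEnvTower τ hC hS) (ContinuousMulEquiv.refl _)).biratUnits A → (BiKummerSetting.mkOfConnectedTemperoidYddTower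
    (Cu.temperedArithmeticGroup e') tf hZ hP NH (Cu.thetaEnvTower τ hC hS) (ContinuousMulEquiv.refl _)).biratUnits A'}
  {θ : (BiKummerSetting.mkOfConnectedTemperoidYddTower (Cu.temperedArithmeticGroup e') tf hZ hP NH (Cu.thetaEnvTower τ hC hS)
    (ContinuousMulEquiv.refl _)).biratUnits (BiKummerSetting.mkOfConnectedTemperoidYddTower (Cu.temperedArithmeticGroup e') tf hZ hP NH
    (Cu.thetaEnvTower τ hC hS) (ContinuousMulEquiv.refl _)).Aodot}
  {Bl : (BiKummerSetting.mkOfConnectedTemperoidYddTower (Cu.temperedArithmeticGroup e') tf hZ hP NH (Cu.thetaEnvTower τ hC hS)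
    (ContinuousMulEquiv.refl _)).C}
  {Pl : (BiKummerSetting.mkOfConnectedTemperoidYddTower (Cu.temperedArithmeticGroup e') tf hZ hP NH (Cu.thetaEnvTower τ hC hS)
    (ContinuousMulEquiv.refl _)).FractionPair θ Bl}
  {Rl : (BiKummerSetting.mkOfConnectedTemperoidYddTower (Cu.temperedArithmeticGroup e') tf hZ hP NH (Cu.thetaEnvTower τ hC hS)
    (ContinuousMulEquiv.refl _)).NthRoot θ Pl Cu.lPNat pullFrac}
  (h : ModelFrobenioid.Hypotheses tf.divisorMonoid tf.ratFnFunctor)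
  (Q : FrobenioidTheta.ThetaSubquotientStub.{0} (ConnectedPart (BTemp (Cu.temperedArithmeticGroup e').Pi)))
  (R : ∀ N : ℕ+, (BiKummerSetting.mkOfConnectedTemperoidYddTower (Cu.temperedArithmeticGroup e') tf hZ hP NH (Cu.thetaEnvTower τ hC hS)
    (ContinuousMulEquiv.refl _)).NthRoot Rl.root Rl.pair N pullFrac)
  (K' : Type) [Field K'] {X₀ : ConnectedPart (BTemp (Cu.temperedArithmeticGroup e').Pi)}
  (hX₀ : ∀ Y : ConnectedPart (BTemp (Cu.temperedArithmeticGroup e').Pi), Subsingleton (Y ⟶ X₀))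
  (t : ∀ N : ℕ+, (R N).BN.base ⟶ X₀) (c₀ : K'ˣ →* (tf.ratFnFunctor.obj (op X₀))ˣ)
  (hc₀ : Function.Injective c₀) (ht : ∀ N : ℕ+, Function.Injective (tf.ratFnFunctor.map (t N).op).hom)
  (hinvc : ∀ (N : ℕ+) (g : Aut (R N).AN.base), pull tf.divisorMonoid g.hom (ModelFrobenioid.div (R N).pair.num) = ModelFrobenioid.div (R
    N).pair.num)
  (α : ∀ {N N' : ℕ+}, (N : ℕ) ∣ N' → ((R N').AN ⟶ (R N).AN))
  (β : ∀ {N N' : ℕ+}, (N : ℕ) ∣ N' → ((R N').BN ⟶ (R N).BN))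
  (comm_sCap : ∀ {N N' : ℕ+} (hd : (N : ℕ) ∣ N'), (R N').pair.num ≫ β hd = α hd ≫ (R N).pair.num)
  (comm_sCup : ∀ {N N' : ℕ+} (hd : (N : ℕ) ∣ N'), (R N').pair.den ≫ β hd = α hd ≫ (R N).pair.den)
  (isIsometry_α : ∀ {N N' : ℕ+} (hd : (N : ℕ) ∣ N'), ((BiKummerSetting.mkOfConnectedTemperoidYddTower (Cu.temperedArithmeticGroup e') tf hZ hP NH
    (Cu.thetaEnvTower τ hC hS) (ContinuousMulEquiv.refl _)).sec5Stub h).pre.IsIsometry (α hd))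
  (degFr_α : ∀ {N N' : ℕ+} (hd : (N : ℕ) ∣ N'), (((BiKummerSetting.mkOfConnectedTemperoidYddTower (Cu.temperedArithmeticGroup e') tf hZ hP NH
    (Cu.thetaEnvTower τ hC hS) (ContinuousMulEquiv.refl _)).sec5Stub h).pre.degFr (α hd) : ℕ) * N = N')
  (isIsometry_β : ∀ {N N' : ℕ+} (hd : (N : ℕ) ∣ N'), ((BiKummerSetting.mkOfConnectedTemperoidYddTower (Cu.temperedArithmeticGroup e') tf hZ hP NH
    (Cu.thetaEnvTower τ hC hS) (ContinuousMulEquiv.refl _)).sec5Stub h).pre.IsIsometry (β hd))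
  (degFr_β : ∀ {N N' : ℕ+} (hd : (N : ℕ) ∣ N'), (((BiKummerSetting.mkOfConnectedTemperoidYddTower (Cu.temperedArithmeticGroup e') tf hZ hP NH
    (Cu.thetaEnvTower τ hC hS) (ContinuousMulEquiv.refl _)).sec5Stub h).pre.degFr (β hd) : ℕ) * N = N')
  (baseFrob_α : ∀ {N N' : ℕ+} (hd : (N : ℕ) ∣ N'), (BiKummerSetting.mkOfConnectedTemperoidYddTower (Cu.temperedArithmeticGroup e') tf hZ hP NH
    (Cu.thetaEnvTower τ hC hS) (ContinuousMulEquiv.refl _)).IsOfBaseFrobeniusType (α hd))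
  (h44 : BiKummerSetting.Thm44Hyp (BiKummerSetting.mkOfConnectedTemperoidYddTower (Cu.temperedArithmeticGroup e') tf hZ hP NH (Cu.thetaEnvTower τ hC
    hS) (ContinuousMulEquiv.refl _)) (BiKummerSetting.mkOfConnectedTemperoidYddTower (Cu.temperedArithmeticGroup e') tf hZ hP NH (Cu.thetaEnvTower τ
    hC hS) (ContinuousMulEquiv.refl _)))
  (ψ : ∀ A : (BiKummerSetting.mkOfConnectedTemperoidYddTower (Cu.temperedArithmeticGroup e') tf hZ hP NH (Cu.thetaEnvTower τ hC hS)
    (ContinuousMulEquiv.refl _)).C, (BiKummerSetting.mkOfConnectedTemperoidYddTower (Cu.temperedArithmeticGroup e') tf hZ hP NH (Cu.thetaEnvTower τ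
    hC hS) (ContinuousMulEquiv.refl _)).biratUnits A ≃* (BiKummerSetting.mkOfConnectedTemperoidYddTower (Cu.temperedArithmeticGroup e') tf hZ hP NH
    (Cu.thetaEnvTower τ hC hS) (ContinuousMulEquiv.refl _)).biratUnits (h44.Ψ.functor.obj A))
  (hpull : ∀ {A A' : (BiKummerSetting.mkOfConnectedTemperoidYddTower (Cu.temperedArithmeticGroup e') tf hZ hP NH (Cu.thetaEnvTower τ hC hS)
    (ContinuousMulEquiv.refl _)).C} (φ : A' ⟶ A) (f : (BiKummerSetting.mkOfConnectedTemperoidYddTower (Cu.temperedArithmeticGroup e') tf hZ hP NH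
    (Cu.thetaEnvTower τ hC hS) (ContinuousMulEquiv.refl _)).biratUnits A), ψ A' (pullFrac φ f) = pullFrac (h44.Ψ.functor.map φ) (ψ A f))
  (hii : BiKummerSetting.Thm44_ii h44 ψ) (h3 : h44.PreservesFrobeniusStructure) (h4b : h44.PreservesBaseFrobeniusTypeData)
  (h8 : h44.PreservesAmple) (h15a : h44.PreservesFixedByHA ψ) (h15 : h44.PreservesSaturated ψ)
  (D : ∀ N : ℕ+, (BiKummerSetting.mkOfConnectedTemperoidYddTower (Cu.temperedArithmeticGroup e') tf hZ hP NH (Cu.thetaEnvTower τ hC hS)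
    (ContinuousMulEquiv.refl _)).BaseFrobeniusTypeData (α (one_dvd_level N)))

include hX₀ h hc₀ ht comm_sCap comm_sCup isIsometry_α degFr_α isIsometry_β degFr_β hpull hii h3 h4b h8 h15a h15 D in
/-- **[EtTh] Theorem 5.7 — FINAL KNIT v6 at the tower OF THE SETTING, canonical monoid vocabulary `treeMonoidVocab`, (C) supplied by the
étale side WITH THE REPAIRED separation binder `hsep^{(2l)}` (exponent `2·l`; p497402/p498016/p503064), constant field an MLF, `hinvp` from the
kernel `H_⊙`** (twin of p486421 thm 1, otherwise VERBATIM): abc-iut-w6-d049's (e3′)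
`thetaRootPreservedAll_ofThetaSettingYddFamily_final_v6_treeMonoidVocab_of_cor219iiiStd` (p481337) with `hK` := `MLFDivisible.units_eq_one_…`
(p480502) under `[Algebra ℚ_[p] K'] [FiniteDimensional ℚ_[p] K']` and `hinvp := hinvp_family_ofConnectedTemperoidYddTower h R` (p483063) inside
the tower of `hT`; every other binder VERBATIM the source.
[cite: MochizukiEtTh2009, Thm 5.7 p.329–330 (PDF pp.103–104); Prop 3.2 (iii) p.296 (PDF p.70); Prop 4.3 (i) p.317 (PDF p.91); Thm 5.6 p.328 (PDF p.102)] -/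
theorem thetaRootPreservedAll_ofThetaSettingYddFamily_final_v6_treeMonoidVocab_of_cor219iiiStd_of_mlf_of_kernel_of_hsepPow
    (T : ThetaFrobenioidTower.{0} (BiKummerSetting.mkOfConnectedTemperoidYddTower (Cu.temperedArithmeticGroup e') tf hZ hP NH (Cu.thetaEnvTower τ hC
      hS) (ContinuousMulEquiv.refl _)).C (ConnectedPart (BTemp (Cu.temperedArithmeticGroup e').Pi)))
    (hT : T = ofThetaSettingFamily τ hC hS h Q R K' (fun N => (Units.map (tf.ratFnFunctor.map (t N).op).hom).comp c₀) (fun N =>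
      tf.unitsMap_comp_injective (t N) hc₀ (ht N)) hinvc (hinvp_family_ofConnectedTemperoidYddTower h R)
      α β comm_sCap comm_sCup isIsometry_α degFr_α isIsometry_β degFr_β baseFrob_α)
    -- (A) Lemma 5.8's geometric connectedness at EVERY level `N`: «a unit of `B_N` commuting with `s^⊓-gp_N(Im Π^tp_Y̲)` is a constant»
    -- (displayed; its level-1 instance is what v1–v5 discharged from the ONE `ConstantsDictionary` junction binder)
    (hgc : ∀ (N : ℕ+) (u : (T.atLevel N).units (T.BN N)),
      (∀ y ∈ (T.atLevel N).imPiY, T.sgpCap N y * (u : Aut (T.BN N)) * (T.sgpCap N y)⁻¹ = u) →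
        (T.atLevel N).unitsToBirat (T.BN N) u ∈ (T.constEmb N).range)
    {Dcnst : Type u₁} [Category.{v₁} Dcnst] (cnst : D₀ ⥤ Dcnst)
    (G : ConnectedPart (BTemp (Field.absoluteGaloisGroup DS.K)) ⥤ Dcnst)
    (ecn : tf.base ⋙ cnst ≅ QuasiTemperoid.pushforward (Cu.temperedArithmeticGroup e').aug.toMonoidHom (Cu.temperedArithmeticGroup
      e').aug_surjective (Cu.temperedArithmeticGroup e').augIsOpenMap_holds ⋙ G)
    (hP34 : RealifiedDivisorMonoids.Prop34Cnst T₀ cnst)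
    (hF : ∀ {B B' : (BiKummerSetting.mkOfConnectedTemperoidYddTower (Cu.temperedArithmeticGroup e') tf hZ hP NH (Cu.thetaEnvTower τ hC hS)
      (ContinuousMulEquiv.refl _)).C} (φ : B' ⟶ B) (y : (BiKummerSetting.mkOfConnectedTemperoidYddTower (Cu.temperedArithmeticGroup e') tf hZ hP NH
      (Cu.thetaEnvTower τ hC hS) (ContinuousMulEquiv.refl _)).biratUnits B), pullFrac φ y = tf.pullFracModel φ y)
    (hαover : ∀ N : ℕ+, α (one_dvd_level N) ≫ (R 1).α = (R N).α)
    (hcharAN : ∀ N : ℕ+, IsTopCharacteristic (Cu.temperedArithmeticGroup e').Pi (galoisSurjOf (Cu.temperedArithmeticGroup e').isTempered (R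
      N).AN.base.obj (R N).αData.isGalois).ker)
    (hdivA : ∀ αA : h44.Ψ.functor.obj (T.AN 1) ≅ T.AN 1, ∃ ε : Aut (T.AN 1), T.pre.div (αA.inv ≫ h44.Ψ.functor.map (T.sCap 1)) = T.pre.div (ε.hom ≫
      T.sCap 1) ∧ T.pre.div (αA.inv ≫ h44.Ψ.functor.map (T.sCup 1)) = T.pre.div (ε.hom ≫ T.sCup 1))
    {N' : ℕ+} (μ' : DS.CyclotomeMod l' N') (h15iii : DS.Prop15iii ES hC) (L : Cu.CuspLabels)
    (h218i : (Cu.rigidData μ' hC hS h15iii L).Cor218_i)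
    (hL : ∀ (A'' : (BiKummerSetting.mkOfConnectedTemperoidYddTower (Cu.temperedArithmeticGroup e') tf hZ hP NH (Cu.thetaEnvTower τ hC hS)
      (ContinuousMulEquiv.refl _)).C) (N : ℕ+) (g : A''.base ⟶ (R 1).AN.base) (ξ : tf.ratFnFunctor.obj (op (R 1).AN.base)),
      (BiKummerSetting.mkOfConnectedTemperoidYddTower (Cu.temperedArithmeticGroup e') tf hZ hP NH (Cu.thetaEnvTower τ hC hS)
      (ContinuousMulEquiv.refl _)).IsFrobeniusTrivial A'' → (BiKummerSetting.mkOfConnectedTemperoidYddTower (Cu.temperedArithmeticGroup e') tf hZ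
      hP NH (Cu.thetaEnvTower τ hC hS) (ContinuousMulEquiv.refl _)).IsNHSaturatedBsFld (BiKummerSetting.mkOfConnectedTemperoidYddTower
      (Cu.temperedArithmeticGroup e') tf hZ hP NH (Cu.thetaEnvTower τ hC hS) (ContinuousMulEquiv.refl _)).HodotBsFld A'' N →
      divB tf.divisorMonoid tf.ratFnFunctor tf.divBNatTrans (op (R 1).AN.base) ξ = 1 → ∃ ζ : tf.ratFnFunctor.obj (op A''.base), ζ ^ (N : ℕ) =
      pull tf.ratFnFunctor g ξ)
    (h58N : ∀ (N : ℕ+) (c : K'ˣ), ∃ r : tf.biratUnitsModel (R N).BN,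
      (r : tf.ratFnFunctor.obj (op (R N).BN.base)) ^ (N : ℕ) = (tf.ratFnFunctor.map (t N).op).hom (c₀ c : tf.ratFnFunctor.obj (op X₀)))
    -- (C) SUPPLIED BY THE ÉTALE SIDE (abc-iut-w6-d049 p478416): `⋂_N (K^×)^N = 1` (Prop 3.2 (iii)) stays displayed …
    -- (C) Prop. 3.2 (iii) `⋂_N (K'^×)^N = 1` is NO LONGER A BINDER: `K'` is a finite extension of `ℚ_p` for the residue
    -- characteristic `p` OF THE SETTING (print p.322), and the clause is `MLFDivisible.units_eq_one_of_forall_exists_pow_eq` (p480502)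
    [Algebra ℚ_[p] K'] [FiniteDimensional ℚ_[p] K']
    -- … the §5 ↔ §2 dictionary at every level `M ∈ Es` of the tower of the Setting (pins of a COMPATIBLE family `η`) …
    (ι : T.PiX ≃* (Cu.thetaEnvTower τ hC hS).PiX) (hι : ∀ y : T.PiX, y ∈ T.PiYdd ↔ ι y ∈ (Cu.thetaEnvTower τ hC hS).PiYdd)
    (m : ∀ M : Es, (T.atLevel M).muTorsion (T.atLevel M).BN (T.atLevel M).N ≃* ((Cu.thetaEnvTower τ hC hS).level M).mu)
    (hχ : ∀ M : Es, (T.atLevel M).CyclotomicCharacterCompat ((Cu.thetaEnvTower τ hC hS).level M) ι (m M))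
    (HF : ∀ M : Es, (T.atLevel M).Facts)
    (η : ∀ M : Es, (Cu.thetaEnvTower τ hC hS).PiYdd → (Cu.thetaEnvTower τ hC hS).mu M)
    (hη : ∀ M, η M ∈ (Cu.thetaEnvTower τ hC hS).thetaCocycles M)
    (hηc : ∀ (M M' : Es) (hd : (M : ℕ+) ∣ M'), (Cu.thetaEnvTower τ hC hS).red M M' hd ∘ η M' = η M)
    (hpin : ∀ M : Es, (T.atLevel M).ThetaSectionCompat (HF M) ((Cu.thetaEnvTower τ hC hS).level M) ι (m M) hι (η M))
    -- … the étale data on the tower: `(γ, γ_μ)` with F-0652's conclusion SHAPE, glue, translation-freeness, separation across levels …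
    (γ : (Cu.thetaEnvTower τ hC hS).PiX ≃ₜ* (Cu.thetaEnvTower τ hC hS).PiX)
    (hγ : (Cu.thetaEnvTower τ hC hS).PiYdd.map γ.toMulEquiv.toMonoidHom = (Cu.thetaEnvTower τ hC hS).PiYdd)
    (hγ' : ∀ x : (Cu.thetaEnvTower τ hC hS).PiX, x ∈ (Cu.thetaEnvTower τ hC hS).PiYdd → γ x ∈ (Cu.thetaEnvTower τ hC hS).PiYdd)
    (γμ : ∀ M : Es, (Cu.thetaEnvTower τ hC hS).mu M ≃* (Cu.thetaEnvTower τ hC hS).mu M)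
    (hstd : ∃ cf : ∀ M : Es, (Cu.thetaEnvTower τ hC hS).G → (Cu.thetaEnvTower τ hC hS).mu M,
      (∀ M, CycEnvelope.IsEnvCocycle (MonoidHom.id _) ((Cu.thetaEnvTower τ hC hS).chi M) (cf M)) ∧
      (∀ M, IsLocallyConstant (cf M ∘ (Cu.thetaEnvTower τ hC hS).aug)) ∧
      (∀ (M M' : Es) (hd : (M : ℕ+) ∣ M'), (Cu.thetaEnvTower τ hC hS).red M M' hd ∘ cf M' = cf M) ∧
      (∀ M, (Cu.thetaEnvTower τ hC hS).pullbackCocycle M γ hγ (γμ M) '' (Cu.thetaEnvTower τ hC hS).thetaCocycles M =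
        (fun η => η * (cf M ∘ (Cu.thetaEnvTower τ hC hS).aug ∘ (Cu.thetaEnvTower τ hC hS).PiYdd.subtype)) ''
          (Cu.thetaEnvTower τ hC hS).thetaCocycles M) ∧
      ∀ M : Es, ∃ d : (Cu.thetaEnvTower τ hC hS).mu M, ∀ g : (Cu.thetaEnvTower τ hC hS).G,
        cf M g ^ T.l = CycEnvelope.coboundary (MonoidHom.id _) ((Cu.thetaEnvTower τ hC hS).chi M) d g)
    (hγμχ : ∀ (M : Es) (x : (Cu.thetaEnvTower τ hC hS).PiX) (tt : (Cu.thetaEnvTower τ hC hS).mu M),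
      γμ M ((Cu.thetaEnvTower τ hC hS).chi M ((Cu.thetaEnvTower τ hC hS).aug x) tt) =
        (Cu.thetaEnvTower τ hC hS).chi M ((Cu.thetaEnvTower τ hC hS).aug (γ x)) (γμ M tt))
    (hγμred : ∀ (M M' : Es) (hd : (M : ℕ+) ∣ M') (tt : (Cu.thetaEnvTower τ hC hS).mu M'),
      (Cu.thetaEnvTower τ hC hS).red M M' hd (γμ M' tt) = γμ M ((Cu.thetaEnvTower τ hC hS).red M M' hd tt))
    (haug : ∀ x y : (Cu.thetaEnvTower τ hC hS).PiX, (Cu.thetaEnvTower τ hC hS).aug x = (Cu.thetaEnvTower τ hC hS).aug y →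
      (Cu.thetaEnvTower τ hC hS).aug (γ x) = (Cu.thetaEnvTower τ hC hS).aug (γ y))
    (hinfη : ∀ (M : Es) (k k' : (Cu.thetaEnvTower τ hC hS).PiYdd), (Cu.thetaEnvTower τ hC hS).aug k = (Cu.thetaEnvTower τ hC hS).aug k' →
      (η M k)⁻¹ * γμ M (η M ⟨γ.symm k, (Cu.thetaEnvTower τ hC hS).symm_apply_mem_PiYdd_of_map_eq γ hγ k k.2⟩) =
        (η M k')⁻¹ * γμ M (η M ⟨γ.symm k', (Cu.thetaEnvTower τ hC hS).symm_apply_mem_PiYdd_of_map_eq γ hγ k' k'.2⟩))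
    (hsep : ∀ η' : ∀ M : Es, (Cu.thetaEnvTower τ hC hS).PiYdd → (Cu.thetaEnvTower τ hC hS).mu M,
      (∀ M, η' M ∈ (Cu.thetaEnvTower τ hC hS).thetaCocycles M) →
      (∀ (M M' : Es) (hd : (M : ℕ+) ∣ M'), (Cu.thetaEnvTower τ hC hS).red M M' hd ∘ η' M' = η' M) →
      (∀ (M : Es) (k k' : (Cu.thetaEnvTower τ hC hS).PiYdd), (Cu.thetaEnvTower τ hC hS).aug k = (Cu.thetaEnvTower τ hC hS).aug k' →
        η' M k * (η M k)⁻¹ = η' M k' * (η M k')⁻¹) →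
      ∀ M : Es, ∃ d : (Cu.thetaEnvTower τ hC hS).mu M, ∀ k : (Cu.thetaEnvTower τ hC hS).PiYdd,
        (η' M k * (η M k)⁻¹) ^ (2 * T.l) =
          CycEnvelope.coboundary ((Cu.thetaEnvTower τ hC hS).aug.comp (Cu.thetaEnvTower τ hC hS).PiYdd.subtype)
            ((Cu.thetaEnvTower τ hC hS).chi M) d k)
    -- … and Thm. 5.6 at each family member (base shadow `θ` with its laws, (K4m) at `γ_μ`), quantified EXACTLY like `htorsfam` was
    (hK4fam : ∀ (α₁ : h44.Ψ.functor.obj (T.AN 1) ≅ T.AN 1) (β₁ : h44.Ψ.functor.obj (T.BN 1) ≅ T.BN 1) (u₁ : Aut (T.BN 1))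
      (hu₁ : u₁ ∈ (T.atLevel 1).units (T.BN 1)),
      α₁.inv ≫ h44.Ψ.functor.map (T.sCap 1) ≫ β₁.hom = T.sCap 1 →
      α₁.inv ≫ h44.Ψ.functor.map (T.sCup 1) ≫ β₁.hom = T.sCup 1 ≫ u₁.hom →
      ∀ c : T.Kˣ, (T.atLevel 1).unitsToBirat (T.BN 1) ⟨u₁, hu₁⟩ = T.constEmb 1 c →
      ∀ N (hN : N ∈ Es), ∀ (a : h44.Ψ.functor.obj (T.AN N) ≅ T.AN N) (b : h44.Ψ.functor.obj (T.BN N) ≅ T.BN N) (w : Aut (T.BN N)),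
        w ∈ (T.atLevel N).units (T.BN N) →
        a.inv ≫ h44.Ψ.functor.map (T.sCap N) ≫ b.hom = T.sCap N →
        a.inv ≫ h44.Ψ.functor.map (T.sCup N) ≫ b.hom = T.sCup N ≫ w.hom →
        a.inv ≫ h44.Ψ.functor.map (T.α (one_dvd_level N)) ≫ α₁.hom = T.α (one_dvd_level N) →
        b.inv ≫ h44.Ψ.functor.map (T.β (one_dvd_level N)) ≫ β₁.hom = T.β (one_dvd_level N) →
          ∃ θb : Aut (T.pre.base.obj (T.BN N)) ≃* Aut (T.pre.base.obj (T.BN N)),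
            (T.atLevel N).HB.map θb.toMonoidHom = (T.atLevel N).HB ∧
            (T.atLevel N).StrvTransport h44.Ψ a (Iso.refl _) θb ∧
            (∀ k : T.PiYdd, θb (T.ρ N k) = T.ρ N (ι.symm (γ (ι k)))) ∧
            ∀ x : (Cu.thetaEnvTower τ hC hS).mu ⟨N, hN⟩, (T.atLevel N).psiAut h44.Ψ b
                (((m ⟨N, hN⟩).symm x : (T.atLevel N).muTorsion (T.atLevel N).BN (T.atLevel N).N) : Aut (T.atLevel N).BN) =
              (((m ⟨N, hN⟩).symm (γμ ⟨N, hN⟩ x) : (T.atLevel N).muTorsion (T.atLevel N).BN (T.atLevel N).N) :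
                Aut (T.atLevel N).BN)) :
    T.ThetaRootPreservedAll h44.Ψ := by
  -- Prop. 3.2 (iii) for the MLF `K'`, read on `T.K` (which IS `K'` along `hT`; `rw` on the small goal, not `subst`)
  have hK : ∀ x : T.Kˣ, (∀ N : ℕ+, ∃ d : T.Kˣ, d ^ (N : ℕ) = x) → x = 1 := by
    rw [hT]
    exact MLFDivisible.units_eq_one_of_forall_exists_pow_eq p K'
  exact thetaRootPreservedAll_ofThetaSettingYddFamily_final_v6_treeMonoidVocab_of_cor219iiiStd_of_hsepPow
    Cu τ hC hS h Q R K' hX₀ t c₀ hc₀ ht hinvc (hinvp_family_ofConnectedTemperoidYddTower h R) α β comm_sCap comm_sCup isIsometry_α degFr_α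
    isIsometry_β degFr_β baseFrob_α h44 ψ hpull hii h3 h4b h8 h15a h15 D T hT hgc cnst G ecn hP34 hF hαover hcharAN hdivA μ' h15iii L h218i hL
    h58N hK ι hι m hχ HF η hη hηc hpin γ hγ hγ' γμ hstd hγμχ hγμred haug hinfη hsep hK4fam

end CanonicalV6EMLFKHsepPow

end ThetaFrobenioidTower

end Literature.AnabelianGeometry.EtaleTheta
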